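import Literature.Probability.Process.BrownianPairReversal
import Literature.Probability.Process.PathHittingEvents
import Literature.Probability.RandomPlanarGeometry.BrownianLoopMeasure
import Mathlib.MeasureTheory.Measure.Lebesgue.Complex
import HarnessLib

/-!
# Time reversal of the planar Brownian bridge: late hits are as likely as early hits

Proof file (theorems only). The planar Brownian bridge `b_s = Z_s − s • Z_1` (`s ≤ 1`,
`Z = BrownianLoop.planarBrownian` on `(WienerPair, wienerPair)`) is invariant in law under the time
reversal `s ↦ 1 − s`: the pair of Brownian paths reversed at time `1` has the law of the pair
(`Process.map_pairRev_wienerPair`, `Process.lintegral_comp_pairRev`), and the bridge built on the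
reversed paths is `s ↦ b_{1−s}`. We record the consequence used for Brownian loop masses:

* `lintegral_volume_bridge_hit_late_eq_early` — for `A` closed and `O` open, the expected area of
  the set of starting points `w` for which `w + b` visits `A` at a time in `[1/2, 1]` and avoids `O`
  on `[0, 1]` equals the same quantity with `[1/2, 1]` replaced by `[0, 1/2]`.

The events are transported along the equality of laws through their countable descriptions on
continuous paths (`Process.exists_measurableSet_iff_exists_mem`,
`Process.exists_measurableSet_iff_forall_notMem`). No definition and no named fact is introduced.

## References

* D. Revuz, M. Yor, *Continuous Martingales and Brownian Motion* (1999), Ch. I, Ex. (1.11)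
  (time reversal of Brownian motion). [folklore]
-/

noncomputable section

open MeasureTheory ProbabilityTheory Filter Set Metric Complex
open scoped NNReal ENNReal Topology

namespace Literature.Probability.RandomPlanarGeometry

open Literature.Probability.Process
open BrownianLoop (planarBrownian)

/-- **Late hits are as likely as early hits for the planar Brownian bridge.** For `A` closed and
`O` open,

  `E |{w : (∃ s ∈ [1/2, 1], w + b_s ∈ A) ∧ ∀ s ≤ 1, w + b_s ∉ O}|`
    `= E |{w : (∃ s ≤ 1/2, w + b_s ∈ A) ∧ ∀ s ≤ 1, w + b_s ∉ O}|`,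

`b_s = Z_s − s • Z_1`, `|·|` = area. [folklore] -/
theorem lintegral_volume_bridge_hit_late_eq_early {A : Set ℂ} (hA : IsClosed A) {O : Set ℂ} (hO : IsOpen O) :
    ∫⁻ ω, volume {w : ℂ | (∃ s : ℝ≥0, 2⁻¹ ≤ s ∧ s ≤ 1 ∧
        w + (planarBrownian s ω - (s : ℝ) • planarBrownian 1 ω) ∈ A) ∧
        ∀ s : ℝ≥0, s ≤ 1 → w + (planarBrownian s ω - (s : ℝ) • planarBrownian 1 ω) ∉ O} ∂wienerPair =
    ∫⁻ ω, volume {w : ℂ | (∃ s : ℝ≥0, s ≤ 2⁻¹ ∧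
        w + (planarBrownian s ω - (s : ℝ) • planarBrownian 1 ω) ∈ A) ∧
        ∀ s : ℝ≥0, s ≤ 1 → w + (planarBrownian s ω - (s : ℝ) • planarBrownian 1 ω) ∉ O} ∂wienerPair := by
  -- the bridge of a raw pair of paths read in `ℂ`, translated by `w`
  set Φ : ℝ≥0 → (WienerPair × ℂ) → ℂ := fun s x ↦
    x.2 + ((((x.1.1 s : ℝ) : ℂ) + ((x.1.2 s : ℝ) : ℂ) * I) - (s : ℝ) • (((x.1.1 1 : ℝ) : ℂ) + ((x.1.2 1 : ℝ) : ℂ) * I))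
    with hΦ
  have hΦm : ∀ s, Measurable (Φ s) := fun s ↦ by
    simp only [hΦ]; fun_prop
  obtain ⟨Sl, hSl, hSliff⟩ := exists_measurableSet_iff_exists_mem Φ hΦm hA 2⁻¹ 1
  obtain ⟨Se, hSe, hSeiff⟩ := exists_measurableSet_iff_exists_mem Φ hΦm hA 0 2⁻¹
  obtain ⟨Sa, hSa, hSaiff⟩ := exists_measurableSet_iff_forall_notMem Φ hΦm hO 1
  -- the two functionals of a raw pair
  set Fl : WienerPair → ℝ≥0∞ := fun p ↦ volume (Prod.mk p ⁻¹' (Sl ∩ Sa)) with hFl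
  set Fe : WienerPair → ℝ≥0∞ := fun p ↦ volume (Prod.mk p ⁻¹' (Se ∩ Sa)) with hFe
  have hFlm : Measurable Fl := measurable_measure_prodMk_left (hSl.inter hSa)
  -- continuity of the bridge path of continuous raw paths
  have hcont : ∀ (p : WienerPair) (w : ℂ), Continuous p.1 → Continuous p.2 → Continuous fun s ↦ Φ s (p, w) := by
    intro p w h1 h2
    simp only [hΦ]
    fun_prop
  -- (i) along the Brownian paths: the late event
  have hpath : ∀ (ω : WienerPair) (w : ℂ) (s : ℝ≥0), Φ s (pairPath ω, w) =
      w + (planarBrownian s ω - (s : ℝ) • planarBrownian 1 ω) := fun ω w s ↦ rfl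
  have hFl_path : ∀ ω, Fl (pairPath ω) = volume {w : ℂ | (∃ s : ℝ≥0, 2⁻¹ ≤ s ∧ s ≤ 1 ∧
      w + (planarBrownian s ω - (s : ℝ) • planarBrownian 1 ω) ∈ A) ∧
      ∀ s : ℝ≥0, s ≤ 1 → w + (planarBrownian s ω - (s : ℝ) • planarBrownian 1 ω) ∉ O} := by
    intro ω
    simp only [hFl]
    congr 1
    ext w
    have hc := hcont (pairPath ω) w (continuous_brownian ω.1) (continuous_brownian ω.2)
    simp only [mem_preimage, mem_inter_iff, mem_setOf_eq]
    rw [hSliff _ hc, hSaiff _ hc]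
    simp only [hpath]
  -- (ii) along the reversed paths: the early event
  have hrev : ∀ (ω : WienerPair) (w : ℂ) {s : ℝ≥0}, s ≤ 1 → Φ s (pairRev 1 ω, w) =
      w + (planarBrownian (1 - s) ω - ((1 - s : ℝ≥0) : ℝ) • planarBrownian 1 ω) := by
    intro ω w s hs
    simp only [hΦ, pairRev, revPath_apply_of_le _ hs, revPath_apply_of_le _ (le_refl (1 : ℝ≥0)), tsub_self,
      brownian_zero, Pi.zero_apply, zero_sub, BrownianLoop.planarBrownian, real_smul, NNReal.coe_sub hs,
      NNReal.coe_one]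
    push_cast
    ring
  have hFl_rev : ∀ ω, Fl (pairRev 1 ω) = volume {w : ℂ | (∃ s : ℝ≥0, s ≤ 2⁻¹ ∧
      w + (planarBrownian s ω - (s : ℝ) • planarBrownian 1 ω) ∈ A) ∧
      ∀ s : ℝ≥0, s ≤ 1 → w + (planarBrownian s ω - (s : ℝ) • planarBrownian 1 ω) ∉ O} := by
    intro ω
    simp only [hFl]
    congr 1
    ext w
    have hc := hcont (pairRev 1 ω) w (continuous_revPath 1 ω.1) (continuous_revPath 1 ω.2)
    simp only [mem_preimage, mem_inter_iff, mem_setOf_eq]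
    rw [hSliff _ hc, hSaiff _ hc]
    have h12 : (2⁻¹ : ℝ≥0) ≤ 1 := by norm_num
    constructor
    · rintro ⟨⟨s, hs1, hs2, hs⟩, havoid⟩
      refine ⟨⟨1 - s, ?_, ?_⟩, fun s' hs' ↦ ?_⟩
      · rw [tsub_le_iff_right]
        calc (1 : ℝ≥0) = 2⁻¹ + 2⁻¹ := by norm_num
          _ ≤ 2⁻¹ + s := add_le_add le_rfl hs1
      · rwa [hrev ω w hs2] at hs
      · have h := havoid (1 - s') tsub_le_self
        rwa [hrev ω w tsub_le_self, tsub_tsub_cancel_of_le hs'] at h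
    · rintro ⟨⟨s, hs1, hs⟩, havoid⟩
      refine ⟨⟨1 - s, ?_, tsub_le_self, ?_⟩, fun s' hs' ↦ ?_⟩
      · rw [le_tsub_iff_right (hs1.trans h12)]
        calc 2⁻¹ + s ≤ 2⁻¹ + 2⁻¹ := add_le_add le_rfl hs1
          _ = (1 : ℝ≥0) := by norm_num
      · rw [hrev ω w tsub_le_self, tsub_tsub_cancel_of_le (hs1.trans h12)]
        exact hs
      · rw [hrev ω w hs']
        exact havoid (1 - s') tsub_le_self
  -- (iii) the equality of laws
  calc ∫⁻ ω, volume {w : ℂ | (∃ s : ℝ≥0, 2⁻¹ ≤ s ∧ s ≤ 1 ∧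
          w + (planarBrownian s ω - (s : ℝ) • planarBrownian 1 ω) ∈ A) ∧
          ∀ s : ℝ≥0, s ≤ 1 → w + (planarBrownian s ω - (s : ℝ) • planarBrownian 1 ω) ∉ O} ∂wienerPair
      = ∫⁻ ω, Fl (pairPath ω) ∂wienerPair := by simp_rw [hFl_path]
    _ = ∫⁻ ω, Fl (pairRev 1 ω) ∂wienerPair := (lintegral_comp_pairRev hFlm 1).symm
    _ = _ := by simp_rw [hFl_rev]

end Literature.Probability.RandomPlanarGeometry

end
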